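import Literature.Analysis.UnboundedOperators.SemilinearMildFlow
import Literature.Analysis.UnboundedOperators.WeaklySingularDuhamel
import HarnessLib

/-!
# The smooth local mild flow on every short window, with the a-priori bound

Analysis/UnboundedOperators support file (everything proved; no definitions, no named facts).  A
quantitative form of the smooth local mild flow of

  `y(t) = T(t) y₀ + ∫₀ᵗ T(t − s) f ds − ∫₀ᵗ K(t − s) N(y(s), y(s)) ds`

(D. Henry, *Geometric Theory of Semilinear Parabolic Equations*, LNM 840 (1981), Thm. 3.3.3, Thm. 3.4.4;
A. Pazy, *Semigroups of Linear Operators and Applications to PDE* (1983), Thm. 6.3.1) as needed for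
continuation along a reference trajectory: for contractions `T(t)` strongly continuous, `K(t)` strongly
continuous on `(0, ∞)` with `‖K(t)‖ ≤ C t^{−α}` (`C ≥ 0`, `α < 1`), bounded bilinear `N`, `f ∈ E` and a
radius `ρ > 0` there is `τ₀ > 0` such that **for every window length `0 < τ ≤ τ₀`** there is a solution
map `Ψ : E → C([0, τ]; E)` which is `C^∞` on the ball `‖y₀‖ < ρ`, gives the mild solution from `y₀`,
**satisfies `‖Ψ y₀ (t)‖ ≤ ρ + 1`**, is the unique continuous mild solution, and whose derivative solves
the linearised equation (`exists_smoothMildFlow_forall_le`).  Compared with the sibling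
`exists_smoothMildFlow` (`SemilinearMildFlowLocal.lean`) the two additions are the uniformity of the
admissible window (the smallness conditions `C τ^{1−α} ‖N‖ (ρ + 1)²/(1 − α) ≤ 1/2`, `τ ‖f‖ ≤ 1/2` are
monotone in `τ`) and the bound `ρ + 1` of the invariant ball of the contraction argument
(`Literature.Analysis.Calculus.exists_contDiffOn_quadraticSolutionMap`), which the Lipschitz /
continuation argument in a tube consumes; uniqueness is imported from `exists_smoothMildFlow_of_duhamel`.

## References

* D. Henry, *Geometric Theory of Semilinear Parabolic Equations*, LNM 840, Springer (1981), Thm. 3.3.3,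
  Thm. 3.3.4, Thm. 3.4.4, Cor. 3.4.6. [Henry1981]
* A. Pazy, *Semigroups of Linear Operators and Applications to Partial Differential Equations*, Springer
  (1983), §6.3, Thm. 6.3.1. [Pazy1983]
-/

noncomputable section

open Set Filter MeasureTheory intervalIntegral Metric
open _root_.Topology
open scoped ContDiff

namespace Literature.Analysis.UnboundedOperators

variable {E : Type*} [NormedAddCommGroup E] [NormedSpace ℝ E] [CompleteSpace E]

/-- **The smooth local mild flow on every short window, with the a-priori bound** (Henry 1981,
Thm. 3.3.3, Thm. 3.4.4; Pazy 1983, Thm. 6.3.1).  Let `T(t)` be strongly continuous contractions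
(`t ≥ 0`), `K(t)` bounded operators, strongly continuous on `(0, ∞)`, with `‖K(t)‖ ≤ C t^{−α}` (`C ≥ 0`,
`α < 1`), `N` bounded bilinear, `f ∈ E` and `ρ > 0`.  There is `τ₀ > 0` such that for every
`0 < τ ≤ τ₀` there is `Ψ : E → C([0, τ]; E)`, `C^∞` on the ball `‖y₀‖ < ρ`, such that for `‖y₀‖ < ρ`:
`Ψ y₀` solves `y(t) = T(t)y₀ + ∫₀ᵗ T(t − s) f ds − ∫₀ᵗ K(t − s) N(y(s), y(s)) ds` on `[0, τ]`;
`‖Ψ y₀ (t)‖ ≤ ρ + 1`; every continuous solution on `[0, τ]` equals `Ψ y₀`; and `w = DΨ(y₀) h` solves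
`w(t) = T(t) h − ∫₀ᵗ K(t − s) (N(y(s), w(s)) + N(w(s), y(s))) ds`. [cite: Henry1981, Thm 3.4.4] -/
theorem exists_smoothMildFlow_forall_le (T K : ℝ → E →L[ℝ] E) (hTnorm : ∀ t, 0 ≤ t → ‖T t‖ ≤ 1)
    (hTc : ∀ y : E, Continuous fun t : ℝ => T t y) {α C : ℝ} (hα : α < 1) (hC : 0 ≤ C)
    (hK : ∀ t, 0 < t → ‖K t‖ ≤ C * t ^ (-α)) (hKc : ∀ y : E, ContinuousOn (fun t : ℝ => K t y) (Ioi 0))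
    (N : E →L[ℝ] E →L[ℝ] E) (f : E) {ρ : ℝ} (hρ : 0 < ρ) :
    ∃ τ₀ : ℝ, 0 < τ₀ ∧ ∀ (τ : ℝ) (hτ : 0 < τ), τ ≤ τ₀ → ∃ Ψ : E → C(Icc (0 : ℝ) τ, E),
      ContDiffOn ℝ ∞ Ψ (ball 0 ρ) ∧
      (∀ y₀ ∈ ball (0 : E) ρ, ∀ t : Icc (0 : ℝ) τ,
        Ψ y₀ t = T t y₀ + (∫ s in (0 : ℝ)..(t : ℝ), T ((t : ℝ) - s) f) -
          ∫ s in (0 : ℝ)..(t : ℝ), K ((t : ℝ) - s)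
            (N (Ψ y₀ (Set.projIcc 0 τ hτ.le s)) (Ψ y₀ (Set.projIcc 0 τ hτ.le s)))) ∧
      (∀ y₀ ∈ ball (0 : E) ρ, ∀ t : Icc (0 : ℝ) τ, ‖Ψ y₀ t‖ ≤ ρ + 1) ∧
      (∀ y₀ ∈ ball (0 : E) ρ, ∀ z : C(Icc (0 : ℝ) τ, E),
        (∀ t : Icc (0 : ℝ) τ, z t = T t y₀ + (∫ s in (0 : ℝ)..(t : ℝ), T ((t : ℝ) - s) f) -
          ∫ s in (0 : ℝ)..(t : ℝ), K ((t : ℝ) - s)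
            (N (z (Set.projIcc 0 τ hτ.le s)) (z (Set.projIcc 0 τ hτ.le s)))) → z = Ψ y₀) ∧
      (∀ y₀ ∈ ball (0 : E) ρ, ∀ (h : E) (t : Icc (0 : ℝ) τ),
        fderiv ℝ Ψ y₀ h t = T t h - ∫ s in (0 : ℝ)..(t : ℝ), K ((t : ℝ) - s)
          (N (Ψ y₀ (Set.projIcc 0 τ hτ.le s)) (fderiv ℝ Ψ y₀ h (Set.projIcc 0 τ hτ.le s)) +
            N (fderiv ℝ Ψ y₀ h (Set.projIcc 0 τ hτ.le s)) (Ψ y₀ (Set.projIcc 0 τ hτ.le s)))) := by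
  have hα1 : 0 < 1 - α := by linarith
  -- a short time `τ₀`; the smallness conditions persist on every shorter window
  obtain ⟨τ₀, hτ₀, hτ₀b, hτ₀s⟩ := exists_pos_le_mul_rpow_le (β := 1 - α)
    (M := C / (1 - α) * ‖N‖ * (ρ + 1) ^ 2) (ε := 1 / 2) (b := 1 / (2 * (‖f‖ + 1))) hα1 one_half_pos
    (by positivity)
  refine ⟨τ₀, hτ₀, fun τ hτ hττ₀ => ?_⟩
  have hM0 : 0 ≤ C / (1 - α) * ‖N‖ * (ρ + 1) ^ 2 := by positivity
  have hτs : C / (1 - α) * ‖N‖ * (ρ + 1) ^ 2 * τ ^ (1 - α) ≤ 1 / 2 :=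
    (mul_le_mul_of_nonneg_left (Real.rpow_le_rpow hτ.le hττ₀ hα1.le) hM0).trans hτ₀s
  have hτb : τ ≤ 1 / (2 * (‖f‖ + 1)) := hττ₀.trans hτ₀b
  -- the Duhamel operator on `C([0, τ]; E)` and the two smallness conditions
  obtain ⟨Φ, hΦ, hΦn⟩ := exists_duhamelCLM hτ hα hC K hK hKc
  have hΦN : ‖Φ‖ * ‖N‖ * (ρ + 1) ^ 2 ≤ 1 / 2 :=
    calc ‖Φ‖ * ‖N‖ * (ρ + 1) ^ 2 ≤ (C * τ ^ (1 - α) / (1 - α)) * ‖N‖ * (ρ + 1) ^ 2 := by gcongr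
      _ = C / (1 - α) * ‖N‖ * (ρ + 1) ^ 2 * τ ^ (1 - α) := by ring
      _ ≤ 1 / 2 := hτs
  have hτf : τ * ‖f‖ ≤ 1 / 2 :=
    calc τ * ‖f‖ ≤ 1 / (2 * (‖f‖ + 1)) * ‖f‖ := by gcongr
      _ = ‖f‖ / (2 * (‖f‖ + 1)) := by rw [div_mul_eq_mul_div, one_mul]
      _ ≤ 1 / 2 := by
          rw [div_le_div_iff₀ (by positivity) (by positivity)]
          nlinarith [norm_nonneg f]
  -- ### the operators of the mild formulation
  obtain ⟨A, hA, hAn⟩ := exists_orbitCLM T hTnorm hTc τ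
  obtain ⟨F₀, hF₀, hF₀n⟩ := exists_forcingCurve T hTnorm hTc f τ
  obtain ⟨B, hB, hBn⟩ := exists_nemytskiiBilinearCLM (K := Icc (0 : ℝ) τ) N
  set Q : C(Icc (0 : ℝ) τ, E) →L[ℝ] C(Icc (0 : ℝ) τ, E) →L[ℝ] C(Icc (0 : ℝ) τ, E) :=
    (ContinuousLinearMap.compL ℝ C(Icc (0 : ℝ) τ, E) C(Icc (0 : ℝ) τ, E) C(Icc (0 : ℝ) τ, E) Φ).comp B
    with hQdef
  have hQ : ∀ y z, Q y z = Φ (B y z) := fun y z => rfl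
  set R : ℝ := ρ + 1 with hR
  set L : ℝ := ‖Φ‖ * ‖N‖ with hL
  have hL0 : 0 ≤ L := by positivity
  have hQle : ∀ y z, ‖Q y z‖ ≤ L * ‖y‖ * ‖z‖ := fun y z => by
    rw [hQ]
    calc ‖Φ (B y z)‖ ≤ ‖Φ‖ * ‖B y z‖ := Φ.le_opNorm _
      _ ≤ ‖Φ‖ * (‖N‖ * ‖y‖ * ‖z‖) := by gcongr; exact hBn y z
      _ = L * ‖y‖ * ‖z‖ := by rw [hL]; ring
  have hF₀norm : ‖F₀‖ ≤ 1 / 2 := (ContinuousMap.norm_le _ (by norm_num)).2 fun t =>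
    (hF₀n t).trans ((mul_le_mul_of_nonneg_right t.2.2 (norm_nonneg f)).trans hτf)
  have hself : ∀ g ∈ ball (0 : E) ρ, ‖A g + F₀‖ + L * R ^ 2 ≤ R := fun g hg => by
    have h1 : ‖A g‖ ≤ ρ := (hAn g).trans (mem_ball_zero_iff.1 hg).le
    linarith [norm_add_le (A g) F₀, hΦN]
  have hcontr : 2 * L * R < 1 := by
    have hR1 : 1 < R := by rw [hR]; linarith
    by_contra hcon
    have h1 : R ≤ 2 * L * R * R := by nlinarith
    nlinarith [hΦN]
  -- ### the solution map (uniform contraction principle), now keeping the bound `‖Ψ g‖ ≤ R`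
  obtain ⟨Ψ, hΨs, hΨfix, hΨb, -, hΨd⟩ :=
    Literature.Analysis.Calculus.exists_contDiffOn_quadraticSolutionMap A F₀ Q (by positivity) hL0 hQle
      hself hcontr
  have hmild : ∀ y₀ ∈ ball (0 : E) ρ, ∀ t : Icc (0 : ℝ) τ,
      Ψ y₀ t = T t y₀ + (∫ s in (0 : ℝ)..(t : ℝ), T ((t : ℝ) - s) f) -
        ∫ s in (0 : ℝ)..(t : ℝ), K ((t : ℝ) - s)
          (N (Ψ y₀ (Set.projIcc 0 τ hτ.le s)) (Ψ y₀ (Set.projIcc 0 τ hτ.le s))) := by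
    intro y₀ hy₀ t
    have h := congrArg (fun z : C(Icc (0 : ℝ) τ, E) => z t) (hΨfix y₀ hy₀)
    rw [h, ContinuousMap.sub_apply, ContinuousMap.add_apply, hA, hF₀, hQ, hΦ]
    simp only [hB]
  -- ### unconditional uniqueness, imported from the sibling file
  obtain ⟨Ψ₂, -, -, hΨ₂u, -⟩ :=
    exists_smoothMildFlow_of_duhamel T K hTnorm hTc hα hC hK N f hρ hτ Φ hΦ hΦN hτf
  refine ⟨Ψ, hΨs, hmild, fun y₀ hy₀ t => ?_, fun y₀ hy₀ z hz => ?_, fun y₀ hy₀ h t => ?_⟩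
  · exact (ContinuousMap.norm_coe_le_norm (Ψ y₀) t).trans (hΨb y₀ hy₀)
  · rw [hΨ₂u y₀ hy₀ z hz, hΨ₂u y₀ hy₀ (Ψ y₀) (hmild y₀ hy₀)]
  · -- ### the derivative solves the linearised equation
    have hdv := congrArg (fun z : C(Icc (0 : ℝ) τ, E) => z t) (hΨd y₀ hy₀ h)
    rw [hdv, ContinuousMap.sub_apply, hA, hQ, hQ, ← map_add, hΦ]
    simp only [ContinuousMap.add_apply, hB]

end Literature.Analysis.UnboundedOperators

end
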